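import Literature.Combinatorics.StablePolynomials.BlockPolarization
import Literature.Combinatorics.StablePolynomials.GraceWalshSzegoDisk
import HarnessLib

/-!
# The Grace–Walsh–Szegő coincidence theorem in blocks, for families of convex circular domains
# (Borcea–Brändén II, Theorem 2.1, convex case)

J. Borcea, P. Brändén, *The Lee–Yang and Pólya–Schur programs. II.*, Comm. Pure Appl. Math. 62 (2009)
1595–1631 (arXiv:0809.3087), §2:

> **Theorem 2.1.** Suppose `f(z_{11},…,z_{1κ_1},…,z_{n1},…,z_{nκ_n})` is a multi-affine polynomial in `|κ|`
> complex variables which is symmetric in `{z_{ij} : j ∈ [κ_i]}` for all `i ∈ [n]`, where `κ ∈ ℕⁿ` with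
> `κ_i ≥ 1`. Let further `C_i`, `i ∈ [n]`, be circular domains and `ξ_{ij} ∈ C_i`, `j ∈ [κ_i]`, `i ∈ [n]`.
> Then there exist `ξ_i ∈ C_i`, `i ∈ [n]`, such that
> `f(ξ_{11},…,ξ_{1κ_1},…,ξ_{n1},…,ξ_{nκ_n}) = f(ξ_1,…,ξ_1,…,ξ_n,…,ξ_n)`
> provided that `f` has total degree `κ_i` in `{z_{ij} : j ∈ [κ_i]}` whenever `C_i` is non-convex.
>
> *Proof.* … by considering one variable [block] at a time.

The tree proves the case `C_1 = ⋯ = C_n = H` (`exists_eval_eq_eval_comp`, `BlockPolarization.lean`) by freezing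
all blocks but one and applying the one-block theorem to the slice. This file runs that induction for an
arbitrary family of sets `C_i ⊆ ℂ`, each having the one-block coincidence property on its block
(`HasCoincidenceProperty`), and records that property for every convex circular domain and its closure:
open / closed disks (`GraceWalshSzegoDisk.lean`) and open / closed half-planes (`GraceWalshSzego.lean`). In
particular Theorem 2.1 holds for any family `{C_i}` of (possibly distinct) open or closed disks and
half-planes.

-- TODO(general form): non-convex circular domains `C_i` (exteriors of disks) under the total-degree
-- hypothesis.

## Contents

* `HasCoincidenceProperty C ι` — the one-block Grace–Walsh–Szegő property of a set `C ⊆ ℂ`;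
  `hasCoincidenceProperty_ball/_closedBall/_im_affine_pos/_im_affine_nonneg/_im_pos`.
* **`exists_eval_eq_eval_comp_of_hasCoincidenceProperty`** — Theorem 2.1 for any family of sets with the
  property; **`exists_eval_eq_eval_comp_of_mem_ball`**, **`exists_eval_eq_eval_comp_of_mem_closedBall`**,
  `exists_eval_eq_eval_comp_of_norm_lt_one` — families of open / closed disks, all blocks in `𝔻`.

## References

* [BorceaBranden2009II] J. Borcea, P. Brändén, Comm. Pure Appl. Math. 62 (2009) 1595–1631, §2 Thm 2.1 and
  its proof; §1 Thm 1.1.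
* [BorceaBranden2009] J. Borcea, P. Brändén, Invent. Math. 177 (2009) 541–569, §2.2 Thm 2.3, proof of
  Prop. 2.4.
-/

noncomputable section

open MvPolynomial Finset

namespace Literature.Combinatorics.StablePolynomials

variable {σ τ : Type*} (b : σ → τ)

/-! ## §1 The one-block coincidence property -/

section OneBlock

/-- **The (one-block) Grace–Walsh–Szegő coincidence property of a set `C ⊆ ℂ`** on the variable type `ι`:
every symmetric multi-affine `f ∈ ℂ[z_ι]` takes at any point of `C^ι` a value `f(ζ,…,ζ)` with `ζ ∈ C`
(Theorem 1.1 says every circular domain has it, convex ones without degree proviso).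
[cite: BorceaBranden2009II, §1 Thm. 1.1] -/
def HasCoincidenceProperty (C : Set ℂ) (ι : Type*) : Prop :=
  ∀ f : MvPolynomial ι ℂ, IsMultiAffine f → (∀ e : Equiv.Perm ι, rename (⇑e) f = f) →
    ∀ ξ : ι → ℂ, (∀ j, ξ j ∈ C) → ∃ ζ ∈ C, eval ξ f = eval (fun _ : ι => ζ) f

variable {ι : Type*} [Fintype ι] [DecidableEq ι]

/-- Open disks have the coincidence property. [cite: BorceaBranden2009II, §1 Thm. 1.1 (`C` an open disk)] -/
theorem hasCoincidenceProperty_ball (c : ℂ) {r : ℝ} (hr : 0 < r) :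
    HasCoincidenceProperty {z : ℂ | ‖z - c‖ < r} ι := fun f hf hfs ξ hξ => by
  obtain ⟨ζ, hζ, h⟩ := exists_eval_eq_eval_const_of_mem_ball hf hfs c hr ξ hξ
  exact ⟨ζ, hζ, h⟩

/-- Closed disks have the coincidence property. [cite: BorceaBranden2009II, §1 Thm. 1.1 (`C` a closed
disk)] -/
theorem hasCoincidenceProperty_closedBall (c : ℂ) {r : ℝ} (hr : 0 < r) :
    HasCoincidenceProperty {z : ℂ | ‖z - c‖ ≤ r} ι := fun f hf hfs ξ hξ => by
  obtain ⟨ζ, hζ, h⟩ := exists_eval_eq_eval_const_of_mem_closedBall hf hfs c hr ξ hξ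
  exact ⟨ζ, hζ, h⟩

/-- Open half-planes `{Im(az+b) > 0}` have the coincidence property. [cite: BorceaBranden2009II, §1
Thm. 1.1 (`C` an open half-plane)] -/
theorem hasCoincidenceProperty_im_affine_pos {a : ℂ} (ha : a ≠ 0) (b' : ℂ) :
    HasCoincidenceProperty {z : ℂ | 0 < (a * z + b').im} ι := fun f hf hfs ξ hξ => by
  obtain ⟨ζ, hζ, h⟩ := exists_eval_eq_eval_const_of_im_affine_pos hf hfs ha b' ξ hξ
  exact ⟨ζ, hζ, h⟩

/-- Closed half-planes `{Im(az+b) ≥ 0}` have the coincidence property. [cite: BorceaBranden2009II, §1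
Thm. 1.1 (`C` a closed half-plane)] -/
theorem hasCoincidenceProperty_im_affine_nonneg {a : ℂ} (ha : a ≠ 0) (b' : ℂ) :
    HasCoincidenceProperty {z : ℂ | 0 ≤ (a * z + b').im} ι := fun f hf hfs ξ hξ => by
  obtain ⟨ζ, hζ, h⟩ := exists_eval_eq_eval_const_of_im_affine_nonneg hf hfs ha b' ξ hξ
  exact ⟨ζ, hζ, h⟩

/-- The open upper half-plane has the coincidence property. [cite: BorceaBranden2009II, §1 Thm. 1.1
(`C = H`)] -/
theorem hasCoincidenceProperty_im_pos : HasCoincidenceProperty {z : ℂ | 0 < z.im} ι := fun f hf hfs ξ hξ => by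
  obtain ⟨ζ, hζ, h⟩ := exists_eval_eq_eval_const_of_im_pos hf hfs ξ hξ
  exact ⟨ζ, hζ, h⟩

/-- The open unit disk has the coincidence property. [cite: BorceaBranden2009II, §1 Thm. 1.1 (`C = 𝔻`)] -/
theorem hasCoincidenceProperty_norm_lt_one : HasCoincidenceProperty {z : ℂ | ‖z‖ < 1} ι :=
  fun f hf hfs ξ hξ => by
  obtain ⟨ζ, hζ, h⟩ := exists_eval_eq_eval_const_of_norm_lt_one hf hfs ξ hξ
  exact ⟨ζ, hζ, h⟩

end OneBlock

/-! ## §2 Theorem 2.1: one block at a time -/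

section Blocks

variable [DecidableEq τ]

/-- **Borcea–Brändén II, Theorem 2.1, for a family of domains with the coincidence property** (in particular
any family of open or closed disks and half-planes, possibly different in each block): a multi-affine `F` in
the variables `σ`, symmetric within each block `b⁻¹(i)`, takes at every `W` with `W_v ∈ C_{b(v)}` the same value
as at a point `ζ ∘ b` constant on each block, with `ζ_i ∈ C_i`. Proof as printed: one block at a time, freezing
the other variables and applying the one-block theorem to the slice (the tree's `exists_eval_eq_eval_comp`
is the case `C_i = H`). [cite: BorceaBranden2009II, §2 Thm. 2.1 and its proof ("by considering one variable at
a time")] [cite: BorceaBranden2009, §2.2 proof of Prop. 2.4] -/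
theorem exists_eval_eq_eval_comp_of_hasCoincidenceProperty [Fintype σ] [DecidableEq σ] [Fintype τ]
    (C : τ → Set ℂ) (hC : ∀ i, HasCoincidenceProperty (C i) {v // b v = i}) (hne : ∀ i, (C i).Nonempty)
    {F : MvPolynomial σ ℂ} (hF : IsMultiAffine F) (hFs : IsFiberSymmetric b F)
    (W : σ → ℂ) (hW : ∀ v, W v ∈ C (b v)) :
    ∃ ζ : τ → ℂ, (∀ i, ζ i ∈ C i) ∧ eval W F = eval (ζ ∘ b) F := by
  classical
  suffices h : ∀ s : Finset τ, ∃ ζ : τ → ℂ, (∀ i, ζ i ∈ C i) ∧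
      eval W F = eval (fun v => if b v ∈ s then ζ (b v) else W v) F by
    obtain ⟨ζ, hζ, h⟩ := h univ
    exact ⟨ζ, hζ, by simpa [Function.comp_def] using h⟩
  intro s
  induction s using Finset.induction_on with
  | empty => exact ⟨fun i => (hne i).some, fun i => (hne i).some_mem, by simp⟩
  | insert i s hi ih =>
    obtain ⟨ζ, hζ, hWV⟩ := ih
    set V : σ → ℂ := fun v => if b v ∈ s then ζ (b v) else W v with hV
    have hVmem : ∀ v, V v ∈ C (b v) := fun v => by
      simp only [hV]
      split_ifs
      · exact hζ _
      · exact hW v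
    obtain ⟨ζi, hζi, hG⟩ := hC i (fiberSlice b i V F) (isMultiAffine_fiberSlice b i V hF)
      (fun e => rename_perm_fiberSlice b i V hFs e) (fun u : {v // b v = i} => V u.1) fun u => by
        have h := hVmem u.1
        rwa [u.2] at h
    rw [eval_fiberSlice, eval_fiberSlice, fiberUpdate_self] at hG
    have hfun : fiberUpdate b i V (fun _ => ζi) =
        fun v => if b v ∈ insert i s then Function.update ζ i ζi (b v) else W v := by
      funext v
      simp only [fiberUpdate, hV, Finset.mem_insert]
      by_cases h1 : b v = i
      · simp [h1]
      · simp [h1]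
    refine ⟨Function.update ζ i ζi, fun j => ?_, ?_⟩
    · by_cases hj : j = i
      · subst hj
        simpa using hζi
      · simpa [Function.update_of_ne hj] using hζ j
    · rw [hWV, hG, hfun]

/-- **Theorem 2.1 for a family of open disks** `C_i = {|z - c_i| < r_i}`. [cite: BorceaBranden2009II, §2
Thm. 2.1 (`C_i` open disks, convex)] -/
theorem exists_eval_eq_eval_comp_of_mem_ball [Fintype σ] [DecidableEq σ] [Fintype τ]
    (c : τ → ℂ) (r : τ → ℝ) (hr : ∀ i, 0 < r i)
    {F : MvPolynomial σ ℂ} (hF : IsMultiAffine F) (hFs : IsFiberSymmetric b F)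
    (W : σ → ℂ) (hW : ∀ v, ‖W v - c (b v)‖ < r (b v)) :
    ∃ ζ : τ → ℂ, (∀ i, ‖ζ i - c i‖ < r i) ∧ eval W F = eval (ζ ∘ b) F :=
  exists_eval_eq_eval_comp_of_hasCoincidenceProperty b (fun i => {z : ℂ | ‖z - c i‖ < r i})
    (fun i => hasCoincidenceProperty_ball (c i) (hr i)) (fun i => ⟨c i, by simpa using hr i⟩) hF hFs W hW

/-- **Theorem 2.1 for a family of closed disks** `C_i = {|z - c_i| ≤ r_i}` (`r_i > 0`).
[cite: BorceaBranden2009II, §2 Thm. 2.1 (`C_i` closed disks, convex)] -/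
theorem exists_eval_eq_eval_comp_of_mem_closedBall [Fintype σ] [DecidableEq σ] [Fintype τ]
    (c : τ → ℂ) (r : τ → ℝ) (hr : ∀ i, 0 < r i)
    {F : MvPolynomial σ ℂ} (hF : IsMultiAffine F) (hFs : IsFiberSymmetric b F)
    (W : σ → ℂ) (hW : ∀ v, ‖W v - c (b v)‖ ≤ r (b v)) :
    ∃ ζ : τ → ℂ, (∀ i, ‖ζ i - c i‖ ≤ r i) ∧ eval W F = eval (ζ ∘ b) F :=
  exists_eval_eq_eval_comp_of_hasCoincidenceProperty b (fun i => {z : ℂ | ‖z - c i‖ ≤ r i})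
    (fun i => hasCoincidenceProperty_closedBall (c i) (hr i)) (fun i => ⟨c i, by simpa using (hr i).le⟩)
    hF hFs W hW

/-- **Theorem 2.1 with all blocks in the open unit disk `𝔻`.** [cite: BorceaBranden2009II, §2 Thm. 2.1
(`C_i = 𝔻`)] -/
theorem exists_eval_eq_eval_comp_of_norm_lt_one [Fintype σ] [DecidableEq σ] [Fintype τ]
    {F : MvPolynomial σ ℂ} (hF : IsMultiAffine F) (hFs : IsFiberSymmetric b F)
    (W : σ → ℂ) (hW : ∀ v, ‖W v‖ < 1) :
    ∃ ζ : τ → ℂ, (∀ i, ‖ζ i‖ < 1) ∧ eval W F = eval (ζ ∘ b) F :=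
  exists_eval_eq_eval_comp_of_hasCoincidenceProperty b (fun _ => {z : ℂ | ‖z‖ < 1})
    (fun _ => hasCoincidenceProperty_norm_lt_one) (fun _ => ⟨0, by simp⟩) hF hFs W hW

end Blocks

end Literature.Combinatorics.StablePolynomials

end
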